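import Literature.AnabelianGeometry.SemiGraphs.SubgroupPresentationArithCompat
import HarnessLib

/-!
# The arithmetic action on the coset semi-graphs of a presentation ([SemiAnbd] §5 pp. 62, 65–66)

Mochizuki, *Semi-graphs of anabelioids*, Publ. RIMS **42** (2006), §5: Def. 5.1 (i) p. 62, p. 65,
proof of Thm. 5.4 p. 66 ("entirely parallel" to Thm. 3.7: `Π^temp_𝔊` acts on the trees / finite levels
of the Galois tower, covering the arithmetic action on `𝔾`) [cite: MochizukiSemiAnbd2006, Thm 5.4, p. 66].

PURE GROUP THEORY (cell row T54-B, tower third, file T1c; plan/GAP-LEDGER.md G-w4d053-1).  Under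
`IsArithCompatible` (`SubgroupPresentationArithCompat.lean`) and `Φ`-stability of the level `K`, the
CANONICAL action `arithAct : E →* Aut (P.cosetGraph K)`: vertices `H_w y K ↦ H_{σ_e w} k⁻¹ Φ_e(y) K`,
edges `M_ε y K ↦ M_{σ_e ε} m⁻¹ Φ_e(y) K`, for ANY vertex / edge conjugators `k`, `m`
(`arithAct_vertexMap_vMk`, `arithAct_edgeMap_eMk`); it covers `σ` (`arithAct_comp_proj`), commutes with
the transition maps (`arithAct_trans`) and extends the deck action along the inner action
(`arithAct_eq_deckAct_of_inner`).  These are the shapes `act_proj` / `trans_act` / "`ρ j (ι n) = act j n`"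
of the cell's `ArithLevelData` producer.  Nothing here bears on [IUTchIII] Cor. 3.12.
-/

namespace Literature.AnabelianGeometry.SemiGraphs

namespace SemiGraph

namespace SubgroupPresentation

open CategoryTheory

universe u v

variable {𝔾 : SemiGraph.{u}} {Γ : Type u} [Group Γ] {E : Type v} [Group E]
variable (P : SubgroupPresentation 𝔾 Γ)

/-! ### Equalities of vertices / edges / branches with propositionally equal base -/

section Eq

variable (K : Subgroup Γ)

/-- Vertices with equal base and equal class are equal. [cite: MochizukiSemiAnbd2006, Thm 3.7(iii) p.41] -/
theorem vMk_eq {w w' : 𝔾.Vertex} (h : w = w') {y y' : Γ}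
    (hy : DoubleCoset.mk (P.H w') K y = DoubleCoset.mk (P.H w') K y') : P.vMk K w y = P.vMk K w' y' := by
  subst h; exact congrArg (Sigma.mk w) hy

/-- Edges with equal base and equal class are equal. [cite: MochizukiSemiAnbd2006, Thm 3.7(iii) p.41] -/
theorem eMk_eq {ε ε' : 𝔾.Edge} (h : ε = ε') {y y' : Γ}
    (hy : DoubleCoset.mk (P.M ε') K y = DoubleCoset.mk (P.M ε') K y') : P.eMk K ε y = P.eMk K ε' y' := by
  subst h; exact congrArg (Sigma.mk ε) hy

/-- Branches with equal base branch, equal base edge and equal class are equal.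
[cite: MochizukiSemiAnbd2006, Thm 3.7(iii) p.41] -/
theorem branch_eq {b b' : 𝔾.Branch} (hb : b = b') {ε ε' : 𝔾.Edge} (hε : ε = ε') {y y' : Γ}
    (hy : DoubleCoset.mk (P.M ε') K y = DoubleCoset.mk (P.M ε') K y')
    (h₁ : ε = 𝔾.edgeOf b) (h₂ : ε' = 𝔾.edgeOf b') :
    (⟨(b, ⟨ε, DoubleCoset.mk (P.M ε) K y⟩), h₁⟩ : (P.cosetGraph K).Branch) =
      ⟨(b', ⟨ε', DoubleCoset.mk (P.M ε') K y'⟩), h₂⟩ := by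
  subst hb; subst hε; exact Subtype.ext (Prod.ext rfl (congrArg (Sigma.mk ε) hy))

end Eq

/-! ### Morphisms of coset semi-graphs along a base morphism -/

section MapAlong

variable {P} {K K' : Subgroup Γ}

/-- A morphism `P.cosetGraph K ⟶ P.cosetGraph K'` COVERING a base morphism `τ : 𝔾 ⟶ 𝔾`, from maps on
representatives `fV w`, `fE ε` respecting the double cosets and the branch elements.
[cite: MochizukiSemiAnbd2006, Thm 5.4, p. 66] -/
def mapAlong (τ : 𝔾 ⟶ 𝔾) (fV : 𝔾.Vertex → Γ → Γ) (fE : 𝔾.Edge → Γ → Γ)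
    (hV : ∀ (w : 𝔾.Vertex) (y y' : Γ), DoubleCoset.mk (P.H w) K y = DoubleCoset.mk (P.H w) K y' →
      DoubleCoset.mk (P.H (τ.vertexMap w)) K' (fV w y) = DoubleCoset.mk (P.H (τ.vertexMap w)) K' (fV w y'))
    (hE : ∀ (ε : 𝔾.Edge) (y y' : Γ), DoubleCoset.mk (P.M ε) K y = DoubleCoset.mk (P.M ε) K y' →
      DoubleCoset.mk (P.M (τ.edgeMap ε)) K' (fE ε y) = DoubleCoset.mk (P.M (τ.edgeMap ε)) K' (fE ε y'))
    (hs : ∀ (b : 𝔾.Branch) (w : 𝔾.Vertex), 𝔾.abuts b = some w → ∀ y : Γ,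
      DoubleCoset.mk (P.H (τ.vertexMap w)) K' (fV w (P.s b * y)) =
        DoubleCoset.mk (P.H (τ.vertexMap w)) K' (P.s (τ.branchMap b) * fE (𝔾.edgeOf b) y)) :
    P.cosetGraph K ⟶ P.cosetGraph K' where
  vertexMap x := ⟨τ.vertexMap x.1, Quotient.liftOn' x.2
    (fun y => DoubleCoset.mk (P.H (τ.vertexMap x.1)) K' (fV x.1 y))
    (fun y y' h => hV x.1 y y' (Quotient.sound' h))⟩
  edgeMap x := ⟨τ.edgeMap x.1, Quotient.liftOn' x.2
    (fun y => DoubleCoset.mk (P.M (τ.edgeMap x.1)) K' (fE x.1 y))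
    (fun y y' h => hE x.1 y y' (Quotient.sound' h))⟩
  branchMap p := ⟨(τ.branchMap p.1.1, ⟨τ.edgeMap p.1.2.1, Quotient.liftOn' p.1.2.2
    (fun y => DoubleCoset.mk (P.M (τ.edgeMap p.1.2.1)) K' (fE p.1.2.1 y))
    (fun y y' h => hE _ y y' (Quotient.sound' h))⟩),
      (congrArg τ.edgeMap p.2).trans (τ.edgeOf_branchMap _).symm⟩
  edgeOf_branchMap _ := rfl
  branchMap_injOn := by
    rintro ⟨⟨b₁, E₁⟩, h₁⟩ ⟨⟨b₂, E₂⟩, h₂⟩ (hE : E₁ = E₂) h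
    subst hE
    have hb : τ.branchMap b₁ = τ.branchMap b₂ :=
      congrArg (fun p : (P.cosetGraph K').Branch => p.1.1) h
    have : b₁ = b₂ := τ.branchMap_injOn b₁ b₂ (h₁.symm.trans h₂) hb
    subst this
    rfl
  abuts_branchMap := by
    intro p x hx
    obtain ⟨b, y, rfl⟩ := P.bMk_surjective K p
    rcases hab : 𝔾.abuts b with _ | w
    · rw [P.cosetGraph_abuts_bMk_none K b hab y] at hx
      exact absurd hx (by simp)
    · rw [P.cosetGraph_abuts_bMk K b w hab y] at hx
      cases hx
      change (P.cosetGraph K').abuts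
          ⟨(τ.branchMap b, ⟨τ.edgeMap (𝔾.edgeOf b),
            DoubleCoset.mk (P.M (τ.edgeMap (𝔾.edgeOf b))) K' (fE (𝔾.edgeOf b) y)⟩), _⟩ =
        some (P.vMk K' (τ.vertexMap w) (fV w (P.s b * y)))
      have hb : (⟨(τ.branchMap b, ⟨τ.edgeMap (𝔾.edgeOf b),
            DoubleCoset.mk (P.M (τ.edgeMap (𝔾.edgeOf b))) K' (fE (𝔾.edgeOf b) y)⟩), by
              exact (τ.edgeOf_branchMap _).symm⟩ : (P.cosetGraph K').Branch) =
          P.bMk K' (τ.branchMap b) (fE (𝔾.edgeOf b) y) :=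
        P.branch_eq K' rfl (τ.edgeOf_branchMap b).symm rfl _ _
      rw [hb, P.cosetGraph_abuts_bMk K' (τ.branchMap b) (τ.vertexMap w) (τ.abuts_branchMap b w hab)]
      exact congrArg (fun q : P.VClass K' (τ.vertexMap w) =>
        some (⟨τ.vertexMap w, q⟩ : (P.cosetGraph K').Vertex)) (hs b w hab y).symm

/-- `mapAlong` on vertex representatives. [cite: MochizukiSemiAnbd2006, Thm 5.4, p. 66] -/
theorem mapAlong_vertexMap_vMk (τ : 𝔾 ⟶ 𝔾) (fV fE hV hE hs) (w : 𝔾.Vertex) (y : Γ) :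
    (mapAlong (P := P) (K := K) (K' := K') τ fV fE hV hE hs).vertexMap (P.vMk K w y) =
      P.vMk K' (τ.vertexMap w) (fV w y) := rfl

/-- `mapAlong` on edge representatives. [cite: MochizukiSemiAnbd2006, Thm 5.4, p. 66] -/
theorem mapAlong_edgeMap_eMk (τ : 𝔾 ⟶ 𝔾) (fV fE hV hE hs) (ε : 𝔾.Edge) (y : Γ) :
    (mapAlong (P := P) (K := K) (K' := K') τ fV fE hV hE hs).edgeMap (P.eMk K ε y) =
      P.eMk K' (τ.edgeMap ε) (fE ε y) := rfl

/-- `mapAlong` on branch representatives. [cite: MochizukiSemiAnbd2006, Thm 5.4, p. 66] -/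
theorem mapAlong_branchMap_bMk (τ : 𝔾 ⟶ 𝔾) (fV fE hV hE hs) (b : 𝔾.Branch) (y : Γ) :
    (mapAlong (P := P) (K := K) (K' := K') τ fV fE hV hE hs).branchMap (P.bMk K b y) =
      P.bMk K' (τ.branchMap b) (fE (𝔾.edgeOf b) y) :=
  P.branch_eq K' rfl (τ.edgeOf_branchMap b).symm rfl _ _

/-- `mapAlong τ` covers `τ`. [cite: MochizukiSemiAnbd2006, Thm 5.4, p. 66] -/
theorem mapAlong_comp_proj (τ : 𝔾 ⟶ 𝔾) (fV fE hV hE hs) :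
    mapAlong (P := P) (K := K) (K' := K') τ fV fE hV hE hs ≫ P.cosetGraphProj K' =
      P.cosetGraphProj K ≫ τ := by
  refine SemiGraph.hom_ext _ _ ?_ ?_ ?_ <;> rfl

end MapAlong

/-! ### The arithmetic action -/

section Arith

variable {Φ : E →* MulAut Γ} {σ : E →* Aut 𝔾} (hP : P.IsArithCompatible Φ σ)
variable (K : Subgroup Γ) (hK : ∀ (e : E) (x : Γ), x ∈ K → Φ e x ∈ K)
include hP

/-- A chosen vertex conjugator. [cite: MochizukiSemiAnbd2006, §5 p.65] -/
noncomputable def vConj (e : E) (w : 𝔾.Vertex) : Γ := Classical.choose (hP.exists_isVConj e w)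

/-- The chosen vertex conjugator is one. [cite: MochizukiSemiAnbd2006, §5 p.65] -/
theorem isVConj_vConj (e : E) (w : 𝔾.Vertex) : P.IsVConj Φ σ e w (P.vConj hP e w) :=
  Classical.choose_spec (hP.exists_isVConj e w)

/-- A chosen edge conjugator. [cite: MochizukiSemiAnbd2006, §5 p.65] -/
noncomputable def eConj (e : E) (ε : 𝔾.Edge) : Γ := Classical.choose (hP.exists_isEConj e ε)

/-- The chosen edge conjugator is one. [cite: MochizukiSemiAnbd2006, §5 p.65] -/
theorem isEConj_eConj (e : E) (ε : 𝔾.Edge) : P.IsEConj Φ σ e ε (P.eConj hP e ε) :=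
  Classical.choose_spec (hP.exists_isEConj e ε)

/-- The branch compatibility of the arithmetic maps on representatives.
[cite: MochizukiSemiAnbd2006, Thm 5.4, p. 66] -/
theorem mk_vertex_branch {e : E} {b : 𝔾.Branch} {w : 𝔾.Vertex} (hw : 𝔾.abuts b = some w)
    {k m : Γ} (hk : P.IsVConj Φ σ e w k) (hm : P.IsEConj Φ σ e (𝔾.edgeOf b) m) (y : Γ) :
    DoubleCoset.mk (P.H ((σ e).hom.vertexMap w)) K (k⁻¹ * Φ e (P.s b * y)) =
      DoubleCoset.mk (P.H ((σ e).hom.vertexMap w)) K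
        (P.s ((σ e).hom.branchMap b) * (m⁻¹ * Φ e y)) := by
  obtain ⟨k', hk', hmem⟩ := hm.2 b w rfl hw
  rw [P.mk_vertex_indep K hP hk hk' (P.s b * y)]
  refine (DoubleCoset.eq _ _ _ _).mpr
    ⟨P.s ((σ e).hom.branchMap b) * m⁻¹ * (Φ e (P.s b))⁻¹ * k', hmem, 1, one_mem _, ?_⟩
  simp only [map_mul]; group

/-- The arithmetic morphism of the level-`K` coset semi-graph attached to `e ∈ E` (through chosen
conjugators; independent of the choice by `arithHom_vertexMap_vMk` / `arithHom_edgeMap_eMk`).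
[cite: MochizukiSemiAnbd2006, Thm 5.4, p. 66] -/
noncomputable def arithHom (e : E) : P.cosetGraph K ⟶ P.cosetGraph K :=
  mapAlong (σ e).hom (fun w y => (P.vConj hP e w)⁻¹ * Φ e y) (fun ε y => (P.eConj hP e ε)⁻¹ * Φ e y)
    (fun w _ _ hy => P.mk_vertex_eq_of_mk_eq K hK (P.isVConj_vConj hP e w) hy)
    (fun ε _ _ hy => P.mk_edge_eq_of_mk_eq K hK (P.isEConj_eConj hP e ε) hy)
    (fun b w hw y => P.mk_vertex_branch hP K hw (P.isVConj_vConj hP e w)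
      (P.isEConj_eConj hP e (𝔾.edgeOf b)) y)

/-- **The arithmetic morphism on vertex representatives, for ANY vertex conjugator.**
[cite: MochizukiSemiAnbd2006, Thm 5.4, p. 66] -/
theorem arithHom_vertexMap_vMk {e : E} {w : 𝔾.Vertex} {k : Γ} (hk : P.IsVConj Φ σ e w k) (y : Γ) :
    (P.arithHom hP K hK e).vertexMap (P.vMk K w y) =
      P.vMk K ((σ e).hom.vertexMap w) (k⁻¹ * Φ e y) :=
  congrArg (Sigma.mk _) (P.mk_vertex_indep K hP (P.isVConj_vConj hP e w) hk y)

/-- **The arithmetic morphism on edge representatives, for ANY edge conjugator.**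
[cite: MochizukiSemiAnbd2006, Thm 5.4, p. 66] -/
theorem arithHom_edgeMap_eMk {e : E} {ε : 𝔾.Edge} {m : Γ} (hm : P.IsEConj Φ σ e ε m) (y : Γ) :
    (P.arithHom hP K hK e).edgeMap (P.eMk K ε y) = P.eMk K ((σ e).hom.edgeMap ε) (m⁻¹ * Φ e y) :=
  congrArg (Sigma.mk _) (P.mk_edge_indep K hP (P.isEConj_eConj hP e ε) hm y)

/-- The arithmetic morphism on branch representatives, for ANY edge conjugator.
[cite: MochizukiSemiAnbd2006, Thm 5.4, p. 66] -/
theorem arithHom_branchMap_bMk {e : E} {b : 𝔾.Branch} {m : Γ} (hm : P.IsEConj Φ σ e (𝔾.edgeOf b) m)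
    (y : Γ) :
    (P.arithHom hP K hK e).branchMap (P.bMk K b y) =
      P.bMk K ((σ e).hom.branchMap b) (m⁻¹ * Φ e y) := by
  rw [arithHom, mapAlong_branchMap_bMk]
  have h := P.mk_edge_indep K hP (P.isEConj_eConj hP e (𝔾.edgeOf b)) hm y
  rw [← (σ e).hom.edgeOf_branchMap b] at h
  exact P.branch_eq K rfl rfl h _ _

/-- `arithHom 1 = 𝟙`. [cite: MochizukiSemiAnbd2006, Thm 5.4, p. 66] -/
theorem arithHom_one : P.arithHom hP K hK 1 = 𝟙 (P.cosetGraph K) := by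
  refine P.hom_ext_mk K _ _ (fun w y => ?_) (fun ε y => ?_) (fun b y => ?_)
  · rw [P.arithHom_vertexMap_vMk hP K hK (IsVConj.one w)]
    exact P.vMk_eq K (by rw [map_one]; rfl) (by simp)
  · rw [P.arithHom_edgeMap_eMk hP K hK (IsEConj.one ε)]
    exact P.eMk_eq K (by rw [map_one]; rfl) (by simp)
  · rw [P.arithHom_branchMap_bMk hP K hK (IsEConj.one (𝔾.edgeOf b))]
    exact P.branch_eq K (by rw [map_one]; rfl) (by rw [map_one]; rfl) (by simp) _ _

/-- `arithHom (e₁ * e₂) = arithHom e₂ ≫ arithHom e₁`. [cite: MochizukiSemiAnbd2006, Thm 5.4, p. 66] -/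
theorem arithHom_mul (e₁ e₂ : E) :
    P.arithHom hP K hK (e₁ * e₂) = P.arithHom hP K hK e₂ ≫ P.arithHom hP K hK e₁ := by
  refine P.hom_ext_mk K _ _ (fun w y => ?_) (fun ε y => ?_) (fun b y => ?_)
  · have h₂ := P.isVConj_vConj hP e₂ w
    have h₁ := P.isVConj_vConj hP e₁ ((σ e₂).hom.vertexMap w)
    rw [P.arithHom_vertexMap_vMk hP K hK (h₁.mul h₂), SemiGraph.comp_vertexMap,
      Function.comp_apply, P.arithHom_vertexMap_vMk hP K hK h₂, P.arithHom_vertexMap_vMk hP K hK h₁]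
    exact P.vMk_eq K (by rw [map_mul]; rfl) (by simp [map_mul, mul_assoc])
  · have h₂ := P.isEConj_eConj hP e₂ ε
    have h₁ := P.isEConj_eConj hP e₁ ((σ e₂).hom.edgeMap ε)
    rw [P.arithHom_edgeMap_eMk hP K hK (h₁.mul h₂), SemiGraph.comp_edgeMap, Function.comp_apply,
      P.arithHom_edgeMap_eMk hP K hK h₂, P.arithHom_edgeMap_eMk hP K hK h₁]
    exact P.eMk_eq K (by rw [map_mul]; rfl) (by simp [map_mul, mul_assoc])
  · have h₂ := P.isEConj_eConj hP e₂ (𝔾.edgeOf b)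
    have h₁ := P.isEConj_eConj hP e₁ ((σ e₂).hom.edgeMap (𝔾.edgeOf b))
    have h₁' : P.IsEConj Φ σ e₁ (𝔾.edgeOf ((σ e₂).hom.branchMap b))
        (P.eConj hP e₁ ((σ e₂).hom.edgeMap (𝔾.edgeOf b))) := by
      rw [(σ e₂).hom.edgeOf_branchMap]; exact h₁
    rw [P.arithHom_branchMap_bMk hP K hK (h₁.mul h₂), SemiGraph.comp_branchMap, Function.comp_apply,
      P.arithHom_branchMap_bMk hP K hK h₂, P.arithHom_branchMap_bMk hP K hK h₁']
    exact P.branch_eq K (by rw [map_mul]; rfl) (by rw [map_mul]; rfl)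
      (by simp [map_mul, mul_assoc]) _ _

/-- **The arithmetic action `E →* Aut (P.cosetGraph K)`** on the level-`K` coset semi-graph
(`K` stable under `Φ`). [cite: MochizukiSemiAnbd2006, Thm 5.4, p. 66] -/
noncomputable def arithAct : E →* Aut (P.cosetGraph K) where
  toFun e :=
    { hom := P.arithHom hP K hK e
      inv := P.arithHom hP K hK e⁻¹
      hom_inv_id := by rw [← arithHom_mul, inv_mul_cancel, arithHom_one]
      inv_hom_id := by rw [← arithHom_mul, mul_inv_cancel, arithHom_one] }
  map_one' := by ext : 1; exact P.arithHom_one hP K hK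
  map_mul' e₁ e₂ := by ext : 1; exact P.arithHom_mul hP K hK e₁ e₂

/-- The arithmetic action on vertex representatives, for any vertex conjugator:
`H_w y K ↦ H_{σ_e w} k⁻¹ Φ_e(y) K`. [cite: MochizukiSemiAnbd2006, Thm 5.4, p. 66] -/
theorem arithAct_vertexMap_vMk {e : E} {w : 𝔾.Vertex} {k : Γ} (hk : P.IsVConj Φ σ e w k) (y : Γ) :
    (P.arithAct hP K hK e).hom.vertexMap (P.vMk K w y) =
      P.vMk K ((σ e).hom.vertexMap w) (k⁻¹ * Φ e y) :=
  P.arithHom_vertexMap_vMk hP K hK hk y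

/-- The arithmetic action on edge representatives, for any edge conjugator.
[cite: MochizukiSemiAnbd2006, Thm 5.4, p. 66] -/
theorem arithAct_edgeMap_eMk {e : E} {ε : 𝔾.Edge} {m : Γ} (hm : P.IsEConj Φ σ e ε m) (y : Γ) :
    (P.arithAct hP K hK e).hom.edgeMap (P.eMk K ε y) = P.eMk K ((σ e).hom.edgeMap ε) (m⁻¹ * Φ e y) :=
  P.arithHom_edgeMap_eMk hP K hK hm y

/-- **The arithmetic action COVERS the action on the base semi-graph** (the `act_proj` shape of
`ArithLevelData`). [cite: MochizukiSemiAnbd2006, Thm 5.4, p. 66] -/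
theorem arithAct_comp_proj (e : E) :
    (P.arithAct hP K hK e).hom ≫ P.cosetGraphProj K = P.cosetGraphProj K ≫ (σ e).hom :=
  mapAlong_comp_proj _ _ _ _ _ _

/-- **The arithmetic actions commute with the transition maps** (the `trans_act` shape).
[cite: MochizukiSemiAnbd2006, Thm 5.4, p. 66] -/
theorem arithAct_trans {K K' : Subgroup Γ} (hK : ∀ (e : E) (x : Γ), x ∈ K → Φ e x ∈ K)
    (hK' : ∀ (e : E) (x : Γ), x ∈ K' → Φ e x ∈ K') (h : K ≤ K') (e : E) :
    (P.arithAct hP K hK e).hom ≫ P.cosetGraphTrans h =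
      P.cosetGraphTrans h ≫ (P.arithAct hP K' hK' e).hom :=
  P.hom_ext_mk K _ _ (fun _ _ => rfl) (fun _ _ => rfl) (fun _ _ => rfl)

/-- **The arithmetic action EXTENDS the deck action along the inner action**: if `Φ e = conj g` and
`σ e = 1` then `e` acts as the deck transformation `g` (the shape "`ρ j (ι n) = act j n`").
[cite: MochizukiSemiAnbd2006, Thm 5.4, p. 66] -/
theorem arithAct_eq_deckAct_of_inner [K.Normal] {e : E} {g : Γ} (hΦ : Φ e = MulAut.conj g)
    (hσ : σ e = 1) : P.arithAct hP K hK e = P.deckAct K g := by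
  ext : 1
  refine P.hom_ext_mk K _ _ (fun w y => ?_) (fun ε y => ?_) (fun b y => ?_)
  · change (P.arithHom hP K hK e).vertexMap _ = (P.deckAct K g).hom.vertexMap _
    rw [P.arithHom_vertexMap_vMk hP K hK (IsVConj.of_inner hΦ hσ w), P.deckAct_vertexMap_vMk]
    exact P.vMk_eq K (by rw [hσ]; rfl) (by simp [hΦ, mul_assoc])
  · change (P.arithHom hP K hK e).edgeMap _ = (P.deckAct K g).hom.edgeMap _
    rw [P.arithHom_edgeMap_eMk hP K hK (IsEConj.of_inner hΦ hσ ε), P.deckAct_edgeMap_eMk]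
    exact P.eMk_eq K (by rw [hσ]; rfl) (by simp [hΦ, mul_assoc])
  · change (P.arithHom hP K hK e).branchMap _ = (P.deckAct K g).hom.branchMap _
    rw [P.arithHom_branchMap_bMk hP K hK (IsEConj.of_inner hΦ hσ (𝔾.edgeOf b)),
      P.deckAct_branchMap_bMk]
    exact P.branch_eq K (by rw [hσ]; rfl) (by rw [hσ]; rfl) (by simp [hΦ, mul_assoc]) _ _

/-- Elements of `E` acting trivially on `Γ` up to `K` in the inner way and trivially on `𝔾` act
trivially: if `σ e = 1` and `Φ e = conj g` with `g ∈ K` then `arithAct e = 1`.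
[cite: MochizukiSemiAnbd2006, Thm 5.4, p. 66] -/
theorem arithAct_eq_one_of_inner_mem [K.Normal] {e : E} {g : Γ} (hΦ : Φ e = MulAut.conj g)
    (hσ : σ e = 1) (hg : g ∈ K) : P.arithAct hP K hK e = 1 := by
  rw [P.arithAct_eq_deckAct_of_inner hP K hK hΦ hσ, P.deckAct_eq_one_of_mem K hg]

end Arith

end SubgroupPresentation

end SemiGraph

end Literature.AnabelianGeometry.SemiGraphs
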